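import Literature.AlgebraicGeometry.AbelianSchemes.AbelianSchemeFiniteSubgroupTorsion
import Literature.AlgebraicGeometry.AbelianSchemes.AbelianSchemeTheoremOfCubeUnconditional
import Literature.AlgebraicGeometry.AbelianSchemes.AbelianSchemeSteinOfNoetherian
import Literature.AlgebraicGeometry.Morphisms.ClosedImmersionOfInfinitesimalFactorisationsConnected
import Literature.AlgebraicGeometry.Morphisms.OpenImmersionOfInfinitesimalFactorisations
import Literature.AlgebraicGeometry.Modules.CechPicTorsionThickening
import Literature.AlgebraicGeometry.Limits.SubalgebraDiagram
import HarnessLib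

/-!
# `K(L) → S` is FLAT, hence FINITE ÉTALE, over a Noetherian affine `ℚ`-base (the torsion road; stub (K) of F-3)

Layer `Literature/AlgebraicGeometry/AbelianSchemes`, namespace `Literature.AlgebraicGeometry.AbelianSchemes.AbelianSchemeOver`.
THEOREMS ONLY (no definition, no named fact, no instance, no notation, no `sorry`).  Cell `hodgecm-mathlib` (D-0151), F-3
sub-line `Cruxes/HDel/Lines/F3DualAbelianScheme` stub (K) `stub_F3K` — brick **(T6)** (assembly) of road T (census
`B-provers/B-p03/g20/F3K/CENSUS-F3K-TorsionRoad.B-p03g20.md` 275587c6; author B-p08 (g15)); consumes (T2) ★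
`Modules.CechPic.eq_one_of_pow_eq_one_of_pullback_eq_one` (B-p03 (g20)), (T3)(T4) ★ `AbelianSchemeFiniteSubgroupTorsion`, (T5) ★
`Morphisms.IsClosedImmersion.isOpenImmersion_of_forall_infinitesimal_factors` (B-p12 (g18)).  HC_CM is proved only modulo the 7
printed citations until rung 0 closes; nothing here is about HC.

THE LACK it closes (★ `AbelianSchemeKOfLUnramified` header «WHAT IS NOT HERE»): FLATNESS of `K(L) → Spec R` for `R` an ARBITRARY
Noetherian `ℚ`-algebra (neither a domain nor reduced).  ROAD ([MumfordAV1970] §13 over a field; over a base the torsion argument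
replaces the dual abelian scheme of [MumfordFogartyKirwan1994] Prop. 6.13 (iii)): the representing closed subscheme `i : Z ↪ A` is
finite and formally unramified (★), so `i ^ n = 1` for some `n ≥ 1` (★ (T3)) and `Z` is a closed subscheme `j : Z ↪ A[n]` of the
finite ÉTALE `n`-torsion (★ (T4)).  It is OPEN in `A[n]` — hence flat over `Spec R` — by the infinitesimal criterion ★ (T5): every
infinitesimal neighbourhood `Spec(𝒪_{A[n],t}/𝔪^{k+1}) → A[n]` of a point `t ∈ Z` factors through `Z`.  Indeed, read as a point
`u : T → A` over `Spec R` (`T = Spec(𝒪_{A[n],t}/𝔪^{k+1})`, an Artin local scheme with residue field `κ(t)`), it satisfies `u ^ n = 1`,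
so the class `a := (1_A × u)^*[Λ(L)] ∈ Ȟ¹(A ×_R T, 𝒪^×)` is `n`-TORSION by the theorem of the square (★
`cechPic_pullback_whiskerLeft_mul_mumfordClass_of_isNoetherianRing`), and its restriction to the closed fibre `A ×_R Spec κ(t)` is
TRIVIAL because the reduction of `u` is the point `t ∈ Z = K(L)`; the closed fibre `A_{κ(t)} ↪ A_T` is a surjective closed immersion
along which units lift (★ STEIN `baseChange_appTop_bijective`: `Γ(A_T, 𝒪) = 𝒪/𝔪^{k+1} ↠ κ(t) = Γ(A_{κ(t)}, 𝒪)`) and `n ∈ ℚ^×` is a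
unit, so TORSION RIGIDITY ★ (T2) gives `a = 1`, i.e. `u ∈ K(L)(T)`, i.e. `T → A[n]` factors through `Z` (representability ★).

* §1 `pullback_whiskerLeft_pow_mumfordClass` — `(1 × u^n)^*[Λ]c = ((1 × u)^*[Λ]c)^n` (★ square, ★ `Λ(·,1) = 1`).
* §2 Artin-local points: `exists_isUnit_appTop_specMap_of_surjective` (units of `Γ(Spec C)` lift to units of `Γ(Spec B)` along a
  surjection `B ↠ C` from a local ring), `exists_isUnit_appTop_whiskerLeft` (… hence along `A ×_R Spec C ↪ A ×_R Spec B`, by ★ Stein),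
  `isUnit_natCast_Γ` (`n ∈ Γ(A ×_R T, 𝒪)^×` over a `ℚ`-algebra).
* §3 **`exists_infinitesimal_fac_of_pow_eq_one`** — the core: for `q : G → A` over `Spec R` with `q ^ n = 1` (`n ≥ 1`), `G` locally
  Noetherian, and `j : Z → G` with `j ≫ q = i`, every infinitesimal neighbourhood in `G` of a point of `j(Z)` factors through `j`.
* §4 **`flat_hom_of_kOfL`** — `Flat Z.hom` for the representing subscheme of `K(L)`; **`exists_kOfL_etale`** — ★
  `exists_kOfL_etale_of_flat` with the flatness DISCHARGED: `K(L)` is represented by a closed subgroup scheme FINITE ÉTALE over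
  `Spec R` — the letter of `stub_F3K` (`Cruxes/HDel/Lines/F3DualAbelianScheme.lean` :109) token for token.

## References
* [MumfordAV1970] D. Mumford, *Abelian Varieties* (1970), §13 (p. 123) (`K(L)` finite, `K(L) ⊆ X[n]`), §6 Cor. 4 (p. 59).
* [MumfordFogartyKirwan1994] D. Mumford, J. Fogarty, F. Kirwan, *GIT*, 3rd ed. (1994), Ch. 6 §2 Prop. 6.13 (iii) (p. 123), Lemma 6.12.
* [GortzWedhorn2023] U. Görtz, T. Wedhorn, *Algebraic Geometry II* (2023), Prop. 27.187, Cor. 27.63, Cor. 24.63 (p. 404).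
* [SGA1] A. Grothendieck, *SGA 1*, Exp. I Cor. 5.6, Thm. 6.1 (open-and-closed subschemes of étale schemes).
-/

set_option autoImplicit false

noncomputable section

-- `TopCat.Presheaf`/`Scheme.Modules` are not reducible (as in ★ `AbelianSchemeKOfL`).
set_option backward.isDefEq.respectTransparency false

open CategoryTheory CategoryTheory.Limits AlgebraicGeometry MonoidalCategory CartesianMonoidalCategory IsLocalRing

open scoped MonObj

namespace Literature.AlgebraicGeometry.AbelianSchemes

open Literature.AlgebraicGeometry.Motives Literature.AlgebraicGeometry.Limits Literature.AlgebraicGeometry.Modules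
  Literature.AlgebraicGeometry.Morphisms

namespace AbelianSchemeOver

variable {R : Type} [CommRing R] (A : AbelianSchemeOver (Spec (.of R)))

/-! ## §1 `u ↦ (1_A × u)^*[Λ]c` is multiplicative: powers -/

section Powers

variable [IsNoetherianRing R] (c : CechPic A.left) (hc : CechPic.pullback A.unitSection c = 1)

include hc in
/-- **`(1_A × u^n)^*[Λ]c = ((1_A × u)^*[Λ]c)^n`** in `Ȟ¹(A ×_R T, 𝒪^×)`: the theorem of the square over a Noetherian affine base (★
`cechPic_pullback_whiskerLeft_mul_mumfordClass_of_isNoetherianRing`) and `(1_A × 1)^*[Λ]c = 1` (★ `pullback_whiskerLeft_one_mul`,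
★ `pullback_snd_one`). [cite: MumfordAV1970, §6 Cor. 4 (p. 59)] [cite: MumfordFogartyKirwan1994, Ch. 6 §2 Definition 6.2 (p. 120)] -/
theorem pullback_whiskerLeft_pow_mumfordClass {T : Over (Spec (.of R))} (u : T ⟶ A.X) (n : ℕ) :
    CechPic.pullback (A.X ◁ (u ^ n)).left (A.mumfordClass c) = (CechPic.pullback (A.X ◁ u).left (A.mumfordClass c)) ^ n := by
  induction n with
  | zero =>
    rw [pow_zero, pow_zero, A.pullback_whiskerLeft_mumfordClass_eq_one_iff, A.pullback_whiskerLeft_one_mul,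
      A.pullback_snd_one c hc, mul_one]
  | succ n ih =>
    rw [pow_succ, pow_succ, A.cechPic_pullback_whiskerLeft_mul_mumfordClass_of_isNoetherianRing c hc, ih]

end Powers

/-! ## §2 Artin-local points: lifting units, `n` invertible -/

section Units

/-- **Units lift along `Γ(Spec B, 𝒪) → Γ(Spec C, 𝒪)` for a surjection `ρ : B ↠ C` from a LOCAL ring onto a non-trivial ring**
(e.g. `𝒪/𝔪^{k+1} ↠ κ`): a surjective ring map out of a local ring is local (Mathlib `IsLocalHom.of_surjective`), so any preimage of
a unit is a unit; transported through `Γ(Spec -, 𝒪) ≅ -` (Mathlib `ΓSpecIso`, `ΓSpecIso_inv_naturality`).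
[cite: GortzWedhorn2023, Cor. 24.63 (p. 404) (setting)] -/
theorem exists_isUnit_appTop_specMap_of_surjective {B C : Type} [CommRing B] [CommRing C] [IsLocalRing B] [Nontrivial C]
    (ρ : B →+* C) (hρ : Function.Surjective ρ) (w : Γ(Spec (.of C), ⊤)) (hw : IsUnit w) :
    ∃ v : Γ(Spec (.of B), ⊤), IsUnit v ∧ (Spec.map (CommRingCat.ofHom ρ)).appTop v = w := by
  haveI := IsLocalHom.of_surjective ρ hρ
  obtain ⟨b, hb⟩ := hρ ((Scheme.ΓSpecIso (.of C)).hom w)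
  have hbu : IsUnit b := by
    refine isUnit_of_map_unit ρ b ?_
    rw [hb]
    exact hw.map _
  refine ⟨(Scheme.ΓSpecIso (.of B)).inv b, hbu.map _, ?_⟩
  rw [← CommRingCat.comp_apply, ← Scheme.ΓSpecIso_inv_naturality, CommRingCat.comp_apply]
  change (Scheme.ΓSpecIso (.of C)).inv (ρ b) = w
  rw [hb, ← CommRingCat.comp_apply, Iso.hom_inv_id, CommRingCat.id_apply]

variable [IsNoetherianRing R]

/-- `Γ(T, 𝒪) → Γ(A ×_R T, 𝒪)` is bijective for every `T → Spec R` (★ STEIN `baseChange_appTop_bijective`; `(A.X ⊗ T).left = A ×_R T`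
and `(snd A.X T).left` is the projection). [cite: GortzWedhorn2023, Cor. 24.63 (p. 404)] -/
theorem appTop_snd_left_bijective (T : Over (Spec (.of R))) : Function.Bijective (snd A.X T).left.appTop :=
  A.baseChange_appTop_bijective T.hom

/-- **Units lift along the closed fibre `A ×_R T₀ ↪ A ×_R T` as soon as they lift along `T₀ → T`** (both `Γ`'s are computed on
the base by ★ Stein, and `(1_A × τ) ≫ p_T = p_{T₀} ≫ τ`). [cite: GortzWedhorn2023, Cor. 24.63 (p. 404)] -/
theorem exists_isUnit_appTop_whiskerLeft {T₀ T : Over (Spec (.of R))} (τ : T₀ ⟶ T)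
    (hτ : ∀ w : Γ(T₀.left, ⊤), IsUnit w → ∃ v : Γ(T.left, ⊤), IsUnit v ∧ τ.left.appTop v = w)
    (w : Γ((A.X ⊗ T₀).left, ⊤)) (hw : IsUnit w) :
    ∃ v : Γ((A.X ⊗ T).left, ⊤), IsUnit v ∧ (A.X ◁ τ).left.appTop v = w := by
  -- `w` comes from a unit of the base `T₀`
  obtain ⟨w₀, rfl⟩ := (A.appTop_snd_left_bijective T₀).2 w
  have hw₀ : IsUnit w₀ := by
    obtain ⟨w', hw'⟩ := hw.exists_right_inv
    obtain ⟨w₀', rfl⟩ := (A.appTop_snd_left_bijective T₀).2 w'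
    rw [← map_mul] at hw'
    exact IsUnit.of_mul_eq_one w₀' ((A.appTop_snd_left_bijective T₀).1 (hw'.trans (map_one _).symm))
  obtain ⟨v₀, hv₀, hv⟩ := hτ w₀ hw₀
  refine ⟨(snd A.X T).left.appTop v₀, hv₀.map _, ?_⟩
  rw [← CommRingCat.comp_apply, ← Scheme.Hom.comp_appTop, ← Over.comp_left, whiskerLeft_snd, Over.comp_left, Scheme.Hom.comp_appTop,
    CommRingCat.comp_apply, hv]

omit [IsNoetherianRing R] in
/-- **`n ≠ 0` is a unit in `Γ(X, 𝒪)` for every scheme `X` over a `ℚ`-algebra** (image of `n ∈ ℚ^×`).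
[cite: MumfordAV1970, §13 (p. 123) (characteristic `0` setting)] -/
theorem isUnit_natCast_Γ [Algebra ℚ R] (X : Over (Spec (.of R))) {n : ℕ} (hn0 : 0 < n) : IsUnit (n : Γ(X.left, ⊤)) := by
  let ψ : ℚ →+* Γ(X.left, ⊤) :=
    X.hom.appTop.hom.comp ((Scheme.ΓSpecIso (.of R)).inv.hom.comp (algebraMap ℚ R))
  have h : IsUnit ((n : ℚ)) := isUnit_iff_ne_zero.mpr (Nat.cast_ne_zero.mpr hn0.ne')
  simpa only [map_natCast] using h.map ψ

end Units

/-! ## §3 The core: infinitesimal neighbourhoods in an `n`-torsion `G → A` of points of `Z` factor through `Z` -/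

section Core

variable [IsNoetherianRing R] [Algebra ℚ R] {L : A.left.Modules} (hL : HasRank L 1)
  (hε : CechPic.pullback A.unitSection (detClass (HasRank.isFiniteLocallyFree' hL)) = 1)
  {Z : Over (Spec (.of R))} (i : Z ⟶ A.X)
  (hZ : ∀ (T : Over (Spec (.of R))) (u : T ⟶ A.X), (∃ v : T ⟶ Z, v ≫ i = u) ↔ A.MemKOfL L u)
  {G : Over (Spec (.of R))} (q : G ⟶ A.X) [Mono q] {n : ℕ} (hn0 : 0 < n) (hq : q ^ n = 1) (j : Z ⟶ G) [IsClosedImmersion j.left]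
  (hj : j ≫ q = i)

omit [IsNoetherianRing R] [Algebra ℚ R] in
/-- The quotient `𝒪_{G,t}/𝔪^{k+1}` is a local ring (plumbing for the Artin-local point).
[cite: MumfordAV1970, §13 (p. 123) (setting)] -/
theorem isLocalRing_stalk_quot (t : G.left) (k : ℕ) :
    IsLocalRing (G.left.presheaf.stalk t ⧸ maximalIdeal (G.left.presheaf.stalk t) ^ (k + 1)) := by
  have hJ : maximalIdeal (G.left.presheaf.stalk t) ^ (k + 1) ≠ ⊤ := fun h =>
    (IsLocalRing.maximalIdeal.isMaximal _).ne_top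
      (top_le_iff.1 (h.symm.le.trans (Ideal.pow_le_self (Nat.succ_ne_zero k))))
  haveI : Nontrivial (G.left.presheaf.stalk t ⧸ maximalIdeal (G.left.presheaf.stalk t) ^ (k + 1)) :=
    Ideal.Quotient.nontrivial_iff.mpr hJ
  exact IsLocalRing.of_surjective' (Ideal.Quotient.mk _) Ideal.Quotient.mk_surjective

omit [IsNoetherianRing R] [Algebra ℚ R] in
/-- `Spec(𝒪_{G,t}/𝔪^{k+1})` has exactly one point: every prime of the local ring `𝒪/𝔪^{k+1}` contains the nilpotent ideal
`𝔪/𝔪^{k+1}`, which is the maximal ideal (`𝒪 → 𝒪/𝔪^{k+1}` is local, ★ `isLocalHom_quotient_mk_maximalIdeal_pow`).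
[cite: MumfordAV1970, §13 (p. 123) (setting)] [cite: StacksProject, Tag 00IP (setting)] -/
theorem subsingleton_spec_stalk_quot (t : G.left) (k : ℕ) :
    Subsingleton ↥(Spec (CommRingCat.of (G.left.presheaf.stalk t ⧸ maximalIdeal (G.left.presheaf.stalk t) ^ (k + 1)))) := by
  haveI := isLocalRing_stalk_quot (G := G) t k
  haveI := isLocalHom_quotient_mk_maximalIdeal_pow (G.left.presheaf.stalk t) k
  -- the maximal ideal of the quotient is the image of `𝔪`, and it is nilpotent
  have hle : maximalIdeal (G.left.presheaf.stalk t ⧸ maximalIdeal (G.left.presheaf.stalk t) ^ (k + 1)) ≤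
      (maximalIdeal (G.left.presheaf.stalk t)).map (Ideal.Quotient.mk (maximalIdeal (G.left.presheaf.stalk t) ^ (k + 1))) := by
    intro b hb
    obtain ⟨a, rfl⟩ := Ideal.Quotient.mk_surjective b
    have ha : a ∈ maximalIdeal (G.left.presheaf.stalk t) := by
      rw [IsLocalRing.mem_maximalIdeal] at hb ⊢
      exact fun hu => hb (hu.map _)
    exact Ideal.mem_map_of_mem _ ha
  have hnil : ((maximalIdeal (G.left.presheaf.stalk t)).map
      (Ideal.Quotient.mk (maximalIdeal (G.left.presheaf.stalk t) ^ (k + 1)))) ^ (k + 1) = ⊥ := by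
    rw [← Ideal.map_pow, Ideal.map_quotient_self]
  refine ⟨fun x y => PrimeSpectrum.ext ?_⟩
  have key : ∀ p : PrimeSpectrum (G.left.presheaf.stalk t ⧸ maximalIdeal (G.left.presheaf.stalk t) ^ (k + 1)),
      p.asIdeal = maximalIdeal _ := fun p => by
    refine le_antisymm (IsLocalRing.le_maximalIdeal p.isPrime.ne_top) (hle.trans ?_)
    rw [← Ideal.IsPrime.pow_le_iff (I := (maximalIdeal (G.left.presheaf.stalk t)).map _) (Nat.succ_ne_zero k), hnil]
    exact bot_le
  rw [key x, key y]

include hL hε hZ hn0 hq hj in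
/-- **THE CORE of road T.**  For `q : G → A` over `Spec R` with `q ^ n = 1` (`n ≥ 1`) and `j : Z → G` with `j ≫ q = i` the
representing immersion of `K(L)`: every infinitesimal neighbourhood `Spec(𝒪_{G,t}/𝔪^{k+1}) → G` of a point `t` of `j(Z)` factors
through `j` — see the module docstring (theorem of the square ⇒ `n`-torsion class; reduction in `K(L)` ⇒ trivial on the closed
fibre; ★ Stein ⇒ units lift; TORSION RIGIDITY ★ (T2) ⇒ trivial; representability ★ ⇒ factorisation).
[cite: MumfordAV1970, §13 (p. 123)] [cite: MumfordFogartyKirwan1994, Ch. 6 §2 Prop. 6.13 (iii) (p. 123)] [cite: GortzWedhorn2023, Cor. 24.63 (p. 404)] -/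
theorem exists_infinitesimal_fac_of_pow_eq_one (t : G.left) (ht : t ∈ Set.range j.left.base) (k : ℕ) :
    ∃ v : Spec (.of (G.left.presheaf.stalk t ⧸ maximalIdeal (G.left.presheaf.stalk t) ^ (k + 1))) ⟶ Z.left,
      v ≫ j.left = Spec.map (CommRingCat.ofHom (Ideal.Quotient.mk (maximalIdeal (G.left.presheaf.stalk t) ^ (k + 1)))) ≫
        G.left.fromSpecStalk t := by
  obtain ⟨z, rfl⟩ := ht
  -- notation: the Artin local ring `B = 𝒪/𝔪^{k+1}`, its residue map `ρ : B ↠ κ(t)`, the point `g : Spec B → G`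
  set O := G.left.presheaf.stalk (j.left.base z) with hO
  haveI : IsLocalRing (↑O ⧸ maximalIdeal ↑O ^ (k + 1)) := isLocalRing_stalk_quot (G := G) (j.left.base z) k
  have hle : maximalIdeal ↑O ^ (k + 1) ≤ RingHom.ker (IsLocalRing.residue ↑O) := by
    rw [IsLocalRing.ker_residue]; exact Ideal.pow_le_self (Nat.succ_ne_zero k)
  let ρ : (↑O ⧸ maximalIdeal ↑O ^ (k + 1)) →+* G.left.residueField (j.left.base z) :=
    Ideal.Quotient.lift _ (IsLocalRing.residue ↑O) fun a ha => hle ha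
  have hρ : Function.Surjective ρ := fun x => by
    obtain ⟨a, rfl⟩ := IsLocalRing.residue_surjective x
    exact ⟨Ideal.Quotient.mk _ a, Ideal.Quotient.lift_mk _ _ _⟩
  have hρmk : (CommRingCat.ofHom (Ideal.Quotient.mk (maximalIdeal ↑O ^ (k + 1)))) ≫ CommRingCat.ofHom ρ =
      G.left.residue (j.left.base z) := by
    ext a; rfl
  set g : Spec (.of (↑O ⧸ maximalIdeal ↑O ^ (k + 1))) ⟶ G.left :=
    Spec.map (CommRingCat.ofHom (Ideal.Quotient.mk (maximalIdeal ↑O ^ (k + 1)))) ≫ G.left.fromSpecStalk (j.left.base z) with hg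
  have hgρ : Spec.map (CommRingCat.ofHom ρ) ≫ g = G.left.fromSpecResidueField (j.left.base z) := by
    rw [hg, ← Category.assoc, ← Spec.map_comp, hρmk]; rfl
  -- the Artin point `u : T → A` and its reduction `τ : T₀ → T`
  let T : Over (Spec (.of R)) := Over.mk (g ≫ G.hom)
  let g' : T ⟶ G := Over.homMk g rfl
  let u : T ⟶ A.X := g' ≫ q
  let T₀ : Over (Spec (.of R)) := Over.mk (G.left.fromSpecResidueField (j.left.base z) ≫ G.hom)
  let τ : T₀ ⟶ T := Over.homMk (Spec.map (CommRingCat.ofHom ρ)) (by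
    change Spec.map (CommRingCat.ofHom ρ) ≫ g ≫ G.hom = G.left.fromSpecResidueField (j.left.base z) ≫ G.hom
    rw [← Category.assoc, hgρ])
  -- `u ^ n = 1`, so `a := (1 × u)^*[Λ]c` is `n`-torsion
  have hun : u ^ n = 1 := by
    change (g' ≫ q) ^ n = 1
    rw [← MonObj.comp_pow, hq, MonObj.comp_one]
  have hpow : (CechPic.pullback (A.X ◁ u).left (A.mumfordClass (detClass (HasRank.isFiniteLocallyFree' hL)))) ^ n = 1 := by
    rw [← A.pullback_whiskerLeft_pow_mumfordClass _ hε u n, hun, A.pullback_whiskerLeft_mumfordClass_eq_one_iff,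
      A.pullback_whiskerLeft_one_mul, A.pullback_snd_one _ hε, mul_one]
  -- the reduction `τ ≫ u` is the point `z ∈ Z = K(L)`
  obtain ⟨v₀, hv₀⟩ := IsClosedImmersion.exists_fromSpecResidueField_fac j.left z
  have hmem₀ : A.MemKOfL L (τ ≫ u) := by
    refine (hZ T₀ (τ ≫ u)).mp ⟨Over.homMk v₀ ?_, ?_⟩
    · change v₀ ≫ Z.hom = G.left.fromSpecResidueField (j.left.base z) ≫ G.hom
      rw [← Over.w j, ← Category.assoc, hv₀]
    · ext
      change v₀ ≫ i.left = Spec.map (CommRingCat.ofHom ρ) ≫ g ≫ q.left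
      rw [← hj, Over.comp_left, ← Category.assoc, hv₀, ← Category.assoc, hgρ]
  have hpull : CechPic.pullback (A.X ◁ τ).left
      (CechPic.pullback (A.X ◁ u).left (A.mumfordClass (detClass (HasRank.isFiniteLocallyFree' hL)))) = 1 := by
    rw [← pullback_comp_left, ← MonoidalCategory.whiskerLeft_comp]
    exact (A.memKOfL_iff_mumfordClass hL _).mp hmem₀
  -- the closed fibre `A_{κ(t)} ↪ A_T`: a surjective closed immersion along which units lift; `n` is a unit
  haveI : IsClosedImmersion τ.left := by
    change IsClosedImmersion (Spec.map (CommRingCat.ofHom ρ))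
    exact IsClosedImmersion.spec_of_surjective _ hρ
  haveI : Surjective τ.left := by
    change Surjective (Spec.map (CommRingCat.ofHom ρ))
    haveI : Subsingleton ↥(Spec (CommRingCat.of (↑O ⧸ maximalIdeal ↑O ^ (k + 1)))) :=
      subsingleton_spec_stalk_quot (G := G) (j.left.base z) k
    exact ⟨fun x => ⟨closedPoint _, Subsingleton.elim _ _⟩⟩
  haveI : IsClosedImmersion (A.X ◁ τ).left :=
    MorphismProperty.of_isPullback (P := @IsClosedImmersion) (SubalgApprox.isPullback_whiskerLeft_left A.X τ).flip inferInstance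
  haveI : Surjective (A.X ◁ τ).left := inferInstance
  have hlift : ∀ w : Γ((A.X ⊗ T₀).left, ⊤), IsUnit w → ∃ v : Γ((A.X ⊗ T).left, ⊤), IsUnit v ∧ (A.X ◁ τ).left.appTop v = w :=
    A.exists_isUnit_appTop_whiskerLeft τ
      (fun w hw => exists_isUnit_appTop_specMap_of_surjective ρ hρ w hw)
  have hnu : IsUnit ((n : ℕ) : Γ((A.X ⊗ T).left, ⊤)) := isUnit_natCast_Γ (A.X ⊗ T) hn0
  -- TORSION RIGIDITY (T2): `a = 1`, so `u ∈ K(L)(T)` and `T → G` factors through `Z`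
  have ha : CechPic.pullback (A.X ◁ u).left (A.mumfordClass (detClass (HasRank.isFiniteLocallyFree' hL))) = 1 :=
    CechPic.eq_one_of_pow_eq_one_of_pullback_eq_one (A.X ◁ τ).left hlift hnu hpow hpull
  obtain ⟨v, hv⟩ := (hZ T u).mpr ((A.memKOfL_iff_mumfordClass hL u).mpr ha)
  refine ⟨v.left, ?_⟩
  have hvj : v ≫ j = g' := by
    rw [← cancel_mono q, Category.assoc, hj, hv]
  change v.left ≫ j.left = g'.left
  rw [← Over.comp_left, hvj]

end Core

/-! ## §4 `K(L)` is flat, hence finite étale, over a Noetherian affine `ℚ`-base -/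

section KOfL

variable [IsNoetherianRing R] [Algebra ℚ R] {L : A.left.Modules} (hL : HasRank L 1)
  (hε : CechPic.pullback A.unitSection (detClass (HasRank.isFiniteLocallyFree' hL)) = 1)

omit [IsNoetherianRing R] [Algebra ℚ R] in
/-- The unit section `e_A : Spec R → A` is a closed immersion (a section of the separated `A → Spec R`).
[cite: MumfordFogartyKirwan1994, Ch. 6 §1 Definition 6.1 (p. 115)] -/
theorem isClosedImmersion_unit_left : IsClosedImmersion (η[A.X] : 𝟙_ _ ⟶ A.X).left := by
  haveI : IsProper A.X.hom := A.isProper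
  haveI : IsClosedImmersion ((η[A.X] : 𝟙_ _ ⟶ A.X).left ≫ A.X.hom) := by
    rw [Over.w (η[A.X]), Over.tensorUnit_hom]
    exact (inferInstance : IsClosedImmersion (𝟙 _))
  exact IsClosedImmersion.of_comp _ A.X.hom

omit [Algebra ℚ R] in
/-- `A` is locally Noetherian (smooth over the Noetherian `Spec R`). [cite: MumfordFogartyKirwan1994, Ch. 6 §1 Definition 6.1 (p. 115)] -/
theorem isLocallyNoetherian_left : IsLocallyNoetherian A.X.left := by
  haveI : Smooth A.X.hom := A.isSmooth
  exact LocallyOfFiniteType.isLocallyNoetherian A.X.hom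

omit [IsNoetherianRing R] [Algebra ℚ R] in
/-- `(A[n] → A) ≫ (A → Spec R) = (A[n] → Spec R)`. [cite: MumfordFogartyKirwan1994, Ch. 6 §2 Lemma 6.12 (p. 122)] -/
theorem pullback_snd_unit_pow_id_comp_hom (n : ℕ) :
    pullback.snd (η[A.X] : 𝟙_ _ ⟶ A.X).left ((((𝟙 A.X : A.X ⟶ A.X) ^ n) : A.X ⟶ A.X).left) ≫ A.X.hom =
      pullback.fst (η[A.X] : 𝟙_ _ ⟶ A.X).left ((((𝟙 A.X : A.X ⟶ A.X) ^ n) : A.X ⟶ A.X).left) := by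
  rw [← Over.w (((𝟙 A.X : A.X ⟶ A.X) ^ n) : A.X ⟶ A.X), ← Category.assoc, ← pullback.condition, Category.assoc,
    Over.w (η[A.X])]
  exact Category.comp_id _

include hε in
/-- **`K(L) → Spec R` IS FLAT**: for a closed immersion `i : Z ↪ A`, finite and formally unramified over the Noetherian affine
`ℚ`-base and representing `K(L)` (the output of ★ `exists_kOfL_formallyUnramified`), `Z → Spec R` is flat — `i ^ n = 1` (★ (T3)),
`j : Z ↪ A[n]` (★ (T4)), all infinitesimal neighbourhoods in `A[n]` of points of `Z` factor through `j`
(`exists_infinitesimal_fac_of_pow_eq_one`), so `j` is an OPEN immersion (★ (T5)) into the ÉTALE `A[n]` (★ `etale_fst_unit_pow_id`).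
[cite: MumfordAV1970, §13 (p. 123)] [cite: MumfordFogartyKirwan1994, Ch. 6 §2 Prop. 6.13 (iii) (p. 123)] [cite: SGA1, Exp. I Thm. 6.1] -/
theorem flat_hom_of_iff_memKOfL {Z : Over (Spec (.of R))} (i : Z ⟶ A.X) [IsClosedImmersion i.left] [IsFinite Z.hom]
    [FormallyUnramified Z.hom]
    (hZ : ∀ (T : Over (Spec (.of R))) (u : T ⟶ A.X), (∃ v : T ⟶ Z, v ≫ i = u) ↔ A.MemKOfL L u) : Flat Z.hom := by
  obtain ⟨he, hm, hn⟩ := A.exists_one_mul_inv_fac_of_memKOfL i hL hε hZ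
  obtain ⟨n, hn0, hin⟩ := A.exists_pow_eq_one_of_formallyUnramified i he hm hn
  -- `G := A[n] → Spec R`, finite étale; `q : G → A` over `Spec R`, a monomorphism with `q ^ n = 1`
  obtain ⟨hGfin, hGet⟩ := A.isFinite_and_etale_fst_unit_pow_id_of_algebraRat hn0
  let G : Over (Spec (.of R)) :=
    Over.mk (pullback.fst (η[A.X] : 𝟙_ _ ⟶ A.X).left ((((𝟙 A.X : A.X ⟶ A.X) ^ n) : A.X ⟶ A.X).left))
  let q : G ⟶ A.X := Over.homMk (pullback.snd _ _) (A.pullback_snd_unit_pow_id_comp_hom n)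
  haveI : IsClosedImmersion (η[A.X] : 𝟙_ _ ⟶ A.X).left := A.isClosedImmersion_unit_left
  haveI : Mono q.left := by
    change Mono (pullback.snd (η[A.X] : 𝟙_ _ ⟶ A.X).left ((((𝟙 A.X : A.X ⟶ A.X) ^ n) : A.X ⟶ A.X).left))
    infer_instance
  haveI : Mono q := Over.mono_of_mono_left q
  have hq : q ^ n = 1 := Over.OverMorphism.ext (by
    have h1 : q ^ n = q ≫ ((𝟙 A.X : A.X ⟶ A.X) ^ n) := by rw [MonObj.comp_pow, Category.comp_id]
    rw [h1, Hom.one_def, Over.comp_left, Over.comp_left, Over.toUnit_left]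
    exact (pullback.condition).symm)
  -- `j : Z → G` over `Spec R`, a closed immersion with `j ≫ q = i`
  let j : Z ⟶ G := Over.homMk (pullback.lift Z.hom i.left (A.left_comp_pow_id_left_eq i hin).symm)
    (A.pullbackLift_unit_pow_id_fst i hin)
  have hj : j ≫ q = i := Over.OverMorphism.ext (A.pullbackLift_unit_pow_id_snd i hin)
  haveI : IsClosedImmersion j.left := A.isClosedImmersion_pullbackLift_unit_pow_id i hin
  haveI : IsLocallyNoetherian A.X.left := A.isLocallyNoetherian_left
  haveI : IsLocallyNoetherian G.left :=
    inferInstanceAs (IsLocallyNoetherian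
      (pullback (η[A.X] : 𝟙_ _ ⟶ A.X).left ((((𝟙 A.X : A.X ⟶ A.X) ^ n) : A.X ⟶ A.X).left)))
  -- the infinitesimal criterion: `j` is an open immersion into the étale `G`
  haveI : IsOpenImmersion j.left :=
    IsClosedImmersion.isOpenImmersion_of_forall_infinitesimal_factors j.left
      (A.exists_infinitesimal_fac_of_pow_eq_one hL hε i hZ q hn0 hq j hj)
  haveI : Flat G.hom := by
    haveI : Etale G.hom := hGet
    infer_instance
  rw [← Over.w j]
  infer_instance

include hε in
/-- **`K(L)` IS FINITE ÉTALE OVER A NOETHERIAN AFFINE `ℚ`-BASE** — ★ `exists_kOfL_etale_of_flat` with its flatness clause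
DISCHARGED (`flat_hom_of_iff_memKOfL`): for every abelian scheme `A` over a Noetherian `ℚ`-algebra `R` (arbitrary: neither a
domain nor reduced) and every rank-one `L` on `A` rigidified along the identity section and fibrewise of the class of an ample
divisor, `K(L)` is represented by a closed subgroup scheme `Z ↪ A` FINITE and ÉTALE over `Spec R` — the letter of stub (K)
`stub_F3K` of `Cruxes/HDel/Lines/F3DualAbelianScheme.lean`. [cite: MumfordAV1970, §13 (p. 123)]
[cite: MumfordFogartyKirwan1994, Ch. 6 §2 Prop. 6.13 (iii) (p. 123)] [cite: GortzWedhorn2023, Prop. 27.187 and Cor. 27.63] -/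
theorem exists_kOfL_etale
    (hΘ : ∀ ⦃Ω : Type⦄ [Field Ω] [IsAlgClosed Ω] (s : Spec (.of Ω) ⟶ Spec (.of R)),
      ∃ Θ : CartierDivisor (A.fibre s).toAbelianVariety.X.left, Θ.IsAmple ∧
        CechPic.pullback (X := (A.fibre s).toAbelianVariety.X.left) (pullback.fst A.X.hom s)
          (detClass (HasRank.isFiniteLocallyFree' hL)) = Θ.cechClass) :
    ∃ (Z : Over (Spec (.of R))) (i : Z ⟶ A.X) (_ : IsClosedImmersion i.left) (_ : IsFinite Z.hom) (_ : Etale Z.hom),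
      ∀ (T : Over (Spec (.of R))) (u : T ⟶ A.X), (∃ v : T ⟶ Z, v ≫ i = u) ↔ A.MemKOfL L u := by
  obtain ⟨Z, i, hci, hfin, hunr, het, hZ⟩ := A.exists_kOfL_etale_of_flat hL hε hΘ
  exact ⟨Z, i, hci, hfin, het (A.flat_hom_of_iff_memKOfL hL hε i hZ), hZ⟩

end KOfL

end AbelianSchemeOver

end Literature.AlgebraicGeometry.AbelianSchemes

end
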